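import Mathlib
import Summits.ResolutionOfSingularities.ResolutionOfSingularities.Theorems.HomologicalConductorPersistenceCyclicQuotientVertexIsolated
import HarnessLib

/-!
# Rung S-2 `PersistenceSurface` (stmt-ResolutionOfSingularities-19970), stub C1 (`Sat₄`) — THE VERTEX EXISTS (non-vacuity of
# the binders of the toric `Sat₄` theorem)

[OURS · cell decomp-res · rung S-2; seat leafhand-res-homologicalconduct-17 gen 0]  Nothing here is a statement of the
manuscript under review (Hironaka 2017); AI-written, weaker than expert review.  DEF-FREE.

The toric `Sat₄` theorem of this seat (`…CyclicQuotientCompletionDomain.cohomologyAnnihilatorOfDegree_eq_of_ringEquiv_completion_vertex''`)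
is stated over binders «a maximal `𝔪 ⊆ U` containing `uⁿ, vⁿ`» and «a noetherian local localisation `S` of `U` at `𝔪`».
Both are shown NON-VACUOUS here: the vertex `𝔪₀ = ker (constant coefficient : U → k)` is a maximal ideal containing
`uⁿ, vⁿ` (`n ≥ 1`), and `Localization.AtPrime 𝔪` is noetherian (and local, an `IsLocalization.AtPrime` by Mathlib).

* `constantCoeff_X_pow_eq_zero` — `uⁿ`, `vⁿ` have zero constant term;
* `exists_vertex` — a maximal ideal of `U` containing `uⁿ` and `vⁿ`;
* `isNoetherianRing_localization_atPrime` — `U_𝔪` is noetherian.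

(The theorems of this seat are stated over an ABSTRACT localisation `S` (`[IsLocalization.AtPrime S 𝔪] [IsNoetherianRing S]
[IsLocalRing S]`) on purpose: writing `AdicCompletion (maximalIdeal (Localization.AtPrime 𝔪)) (Localization.AtPrime 𝔪)`
does not elaborate — `maximalIdeal` picks `OreLocalization.instCommSemiring` while `AdicCompletion` wants
`CommRing.toCommSemiring` (hand 15's instance-path clash); consumers should keep `S` abstract too.)

References: S. B. Iyengar, R. Takahashi, IMRN 2016 [`IyengarTakahashi2014`] (vocabulary) — tree lemmas only.
-/

-- single-problem summit: the doubled namespace component `ResolutionOfSingularities` is forced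
set_option linter.dupNamespace false

noncomputable section

open IsLocalRing MvPolynomial Literature.RingTheory.CohomologyAnnihilator
open Summit.ResolutionOfSingularities.ResolutionOfSingularities.Theorems.HomologicalConductor.PersistenceCyclicQuotientCharFree
  (isNoetherianRing_degreeZero)
open Summit.ResolutionOfSingularities.ResolutionOfSingularities.Theorems.HomologicalConductor.PersistenceCyclicQuotientVertexIsolated
  (X_pow_mem C_mem)

universe u

namespace Summit.ResolutionOfSingularities.ResolutionOfSingularities.Theorems.HomologicalConductor.PersistenceCyclicQuotientVertex

variable {k : Type u} [Field k] {n : ℕ} [NeZero n] {q : ℕ} (U : Subalgebra k (MvPolynomial (Fin 2) k))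
variable (hU : ∀ p, p ∈ U ↔ weightedHomogeneousComponent (![1, (q : ZMod n)] : Fin 2 → ZMod n) 0 p = p)

omit [Field k] in
/-- `uⁿ` and `vⁿ` (`n ≥ 1`) have zero constant term. [folklore] -/
theorem constantCoeff_X_pow_eq_zero {R : Type u} [CommRing R] (i : Fin 2) :
    constantCoeff ((X i : MvPolynomial (Fin 2) R) ^ n) = 0 := by
  rw [map_pow, constantCoeff_X, zero_pow (NeZero.ne n)]

include hU in
/-- **The vertex exists**: `𝔪₀ = ker (constantCoeff ∘ (U ↪ k[u,v]))` is a maximal ideal of `U` (the composite is onto the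
field `k`, constants being invariant) containing `uⁿ` and `vⁿ`. [folklore] -/
theorem exists_vertex : ∃ (𝔪 : Ideal U) (_ : 𝔪.IsMaximal),
    (⟨(X 0 : MvPolynomial (Fin 2) k) ^ n, X_pow_mem U hU 0⟩ : U) ∈ 𝔪 ∧
      (⟨(X 1 : MvPolynomial (Fin 2) k) ^ n, X_pow_mem U hU 1⟩ : U) ∈ 𝔪 := by
  let φ : U →+* k := (constantCoeff : MvPolynomial (Fin 2) k →+* k).comp (algebraMap U (MvPolynomial (Fin 2) k))
  have hφ : Function.Surjective φ := fun c =>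
    ⟨⟨C c, C_mem U hU c⟩, by simp [φ]⟩
  refine ⟨RingHom.ker φ, RingHom.ker_isMaximal_of_surjective φ hφ, ?_, ?_⟩
  · rw [RingHom.mem_ker]
    exact constantCoeff_X_pow_eq_zero 0
  · rw [RingHom.mem_ker]
    exact constantCoeff_X_pow_eq_zero 1

include hU in
/-- `U_𝔪` is noetherian (`U` is, `…CharFreeHerzog.isNoetherianRing_degreeZero`). [folklore] -/
theorem isNoetherianRing_localization_atPrime (𝔪 : Ideal U) [𝔪.IsMaximal] :
    IsNoetherianRing (Localization.AtPrime 𝔪) :=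
  IsLocalization.isNoetherianRing 𝔪.primeCompl _ (isNoetherianRing_degreeZero (k := k) (n := n) q U hU)

end Summit.ResolutionOfSingularities.ResolutionOfSingularities.Theorems.HomologicalConductor.PersistenceCyclicQuotientVertex

end
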